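import Summits.Ventures.LatticeQCDFlow.Exactness.NonreversibleDirichletComparison
import Summits.Ventures.LatticeQCDFlow.Exactness.AdjointSamplerAutocovariance
import HarnessLib

/-!
# Ordered compositions of reversible exact samplers (the `n`-block SWEEP in row 2's `RevOp` format): the reverse order is the adjoint, forward and backward score identically, the direction-randomised sweep is reversible and never better

HONEST FRAMING: exact (Metropolis-corrected) sampling algorithms for lattice gauge theory;
figures of merit are autocorrelation/cost numbers at stated couplings and volumes; no
continuum-physics claim.

Venture `LatticeQCDFlow` (cell pub-lqcd), topic `Exactness`; FANOUT row 8 (`s0-cpn-nemc`, GEN-24).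
NEW WORK of the cell in row 2's `RevOp` format (weight `w ≥ 0`, admissible class `A` with (int)
(comb); a LIST `ops` of operators each with (stab) (lin) (symm) (contr) on the class), composing
`Exactness/AdjointSamplerAutocovariance` (adjoint pairs: equal autocovariances, additive
reversibilization, positive palindromes) and `Exactness/NonreversibleDirichletComparison` (a
non-reversible sampler never scores worse than a reversible one it dominates in Dirichlet form).
The kernel-level counterparts (Mathlib `Kernel`s, `cycle`, row 9's `IsAdjointPair`) are
`Scoring/AdjointKernelAutocovariance`, `Scoring/KernelNonreversibleComparison`,
`Scoring/PalindromicSweep{Reversible,Positive}`; this file serves operators that are not given as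
kernels (row 2's lattice operators).  Elementary list inductions; nothing is cited as a fact.

## Setting (no definition is introduced)

For `ops : List ((X → ℝ) → (X → ℝ))` the ORDERED COMPOSITION is the operator
`f ↦ ops.foldr (fun P g => P g) f` (`= P₁ (P₂ (⋯ (Pₙ f)))` for `ops = [P₁, …, Pₙ]`), written out in
every statement; the REVERSED composition is the same with `ops.reverse`.

## What is proved (namespace `RevOp`)

* `foldr_mem`, `foldr_lin`, `foldr_contr` — the ordered composition is an exact sampler on the class;
* **`foldr_adjoint`** — `∫ (F f) h w = ∫ f (B h) w` with `F`, `B` the compositions along `ops` and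
  `ops.reverse`: THE REVERSED SWEEP IS THE ADJOINT OF THE FORWARD SWEEP (each factor symmetric);
* hence (one-line applications of `Exactness/AdjointSamplerAutocovariance`, not restated): forward and
  backward sweeps score identically at every lag, and the palindrome `F ∘ B` is a positive reversible
  exact sampler (nonnegative, nonincreasing autocovariances);
* **`foldr_abelSum_le_directionMixture`** — with `S f = ½(F f + B f)` on the class (flip a fair coin
  for the direction): `S` is reversible and `Σ_k ⟨g, Fᵏ g⟩ rᵏ ≤ Σ_k ⟨g, Sᵏ g⟩ rᵏ` for every `g ∈ A`,
  `0 ≤ r < 1` — the fixed direction is never worse.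

NOT CLAIMED: any comparison with the random-SCAN sweep for more than two factors; unbounded weights;
any number of ours.
-/

namespace Summit.Ventures.LatticeQCDFlow.Exactness

open Real MeasureTheory Filter Finset
open Summit.Ventures.LatticeQCDFlow.Scoring

namespace RevOp

variable {X : Type*} [MeasurableSpace X] {μ : Measure X} {w : X → ℝ} {A : (X → ℝ) → Prop}

/-! ## §1 The ordered composition is an exact sampler; the reversed one is its adjoint -/

section Fold

variable {ops : List ((X → ℝ) → (X → ℝ))}

omit [MeasurableSpace X] in
/-- (stab) for the ordered composition. -/
theorem foldr_mem (hst : ∀ P ∈ ops, ∀ ⦃f : X → ℝ⦄, A f → A (P f)) :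
    ∀ ⦃f : X → ℝ⦄, A f → A (ops.foldr (fun P g => P g) f) := by
  induction ops with
  | nil => intro f hf; simpa using hf
  | cons P rest ih =>
    intro f hf
    rw [List.foldr_cons]
    exact hst P (by simp) (ih (fun Q hQ => hst Q (by simp [hQ])) hf)

omit [MeasurableSpace X] in
/-- (lin) for the ordered composition. -/
theorem foldr_lin (hst : ∀ P ∈ ops, ∀ ⦃f : X → ℝ⦄, A f → A (P f))
    (hli : ∀ P ∈ ops, ∀ ⦃f h : X → ℝ⦄ (c : ℝ), A f → A h →
      ∀ x, P (fun s => f s + c * h s) x = P f x + c * P h x) :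
    ∀ ⦃f h : X → ℝ⦄ (c : ℝ), A f → A h →
      ∀ x, ops.foldr (fun P g => P g) (fun s => f s + c * h s) x
        = ops.foldr (fun P g => P g) f x + c * ops.foldr (fun P g => P g) h x := by
  induction ops with
  | nil => intro f h c _ _ x; simp
  | cons P rest ih =>
    intro f h c hf hh x
    have hst' : ∀ Q ∈ rest, ∀ ⦃f : X → ℝ⦄, A f → A (Q f) := fun Q hQ => hst Q (by simp [hQ])
    have hli' : ∀ Q ∈ rest, ∀ ⦃f h : X → ℝ⦄ (c : ℝ), A f → A h →
        ∀ x, Q (fun s => f s + c * h s) x = Q f x + c * Q h x := fun Q hQ => hli Q (by simp [hQ])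
    have e : rest.foldr (fun P g => P g) (fun s => f s + c * h s)
        = fun s => rest.foldr (fun P g => P g) f s + c * rest.foldr (fun P g => P g) h s :=
      funext (ih hst' hli' c hf hh)
    rw [List.foldr_cons, List.foldr_cons, List.foldr_cons, e]
    exact hli P (by simp) c (foldr_mem hst' hf) (foldr_mem hst' hh) x

/-- (contr) for the ordered composition. -/
theorem foldr_contr (hst : ∀ P ∈ ops, ∀ ⦃f : X → ℝ⦄, A f → A (P f))
    (hco : ∀ P ∈ ops, ∀ ⦃f : X → ℝ⦄, A f → ∫ x, P f x ^ 2 * w x ∂μ ≤ ∫ x, f x ^ 2 * w x ∂μ) :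
    ∀ ⦃f : X → ℝ⦄, A f →
      ∫ x, ops.foldr (fun P g => P g) f x ^ 2 * w x ∂μ ≤ ∫ x, f x ^ 2 * w x ∂μ := by
  induction ops with
  | nil => intro f _; simp
  | cons P rest ih =>
    intro f hf
    have hst' : ∀ Q ∈ rest, ∀ ⦃f : X → ℝ⦄, A f → A (Q f) := fun Q hQ => hst Q (by simp [hQ])
    rw [List.foldr_cons]
    exact (hco P (by simp) (foldr_mem hst' hf)).trans
      (ih hst' (fun Q hQ => hco Q (by simp [hQ])) hf)

/-- **THE REVERSED SWEEP IS THE ADJOINT OF THE FORWARD SWEEP**: if every factor is symmetric on the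
class, `∫ (F f) h w = ∫ f (B h) w` with `F` the composition along `ops` and `B` along `ops.reverse`. -/
theorem foldr_adjoint (hst : ∀ P ∈ ops, ∀ ⦃f : X → ℝ⦄, A f → A (P f))
    (hsy : ∀ P ∈ ops, ∀ ⦃f h : X → ℝ⦄, A f → A h →
      ∫ x, P f x * h x * w x ∂μ = ∫ x, f x * P h x * w x ∂μ) :
    ∀ ⦃f h : X → ℝ⦄, A f → A h →
      ∫ x, ops.foldr (fun P g => P g) f x * h x * w x ∂μ
        = ∫ x, f x * ops.reverse.foldr (fun P g => P g) h x * w x ∂μ := by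
  induction ops with
  | nil => intro f h _ _; simp
  | cons P rest ih =>
    intro f h hf hh
    have hst' : ∀ Q ∈ rest, ∀ ⦃f : X → ℝ⦄, A f → A (Q f) := fun Q hQ => hst Q (by simp [hQ])
    have hsy' : ∀ Q ∈ rest, ∀ ⦃f h : X → ℝ⦄, A f → A h →
        ∫ x, Q f x * h x * w x ∂μ = ∫ x, f x * Q h x * w x ∂μ := fun Q hQ => hsy Q (by simp [hQ])
    rw [List.foldr_cons, hsy P (by simp) (foldr_mem hst' hf) hh, List.reverse_cons,
      List.foldr_append, List.foldr_cons, List.foldr_nil]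
    exact ih hst' hsy' hf (hst P (by simp) hh)

omit [MeasurableSpace X] in
/-- The factors of `ops.reverse` inherit (stab). -/
theorem reverse_mem (hst : ∀ P ∈ ops, ∀ ⦃f : X → ℝ⦄, A f → A (P f)) :
    ∀ P ∈ ops.reverse, ∀ ⦃f : X → ℝ⦄, A f → A (P f) :=
  fun P hP => hst P (List.mem_reverse.mp hP)

end Fold

/-! ## §2 Consequences: direction does not matter; randomising it never helps; palindromes are positive -/

section Consequences

variable {ops : List ((X → ℝ) → (X → ℝ))} {S : (X → ℝ) → (X → ℝ)}
  (hw0 : ∀ x, 0 ≤ w x)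
  (hAi : ∀ ⦃f h : X → ℝ⦄, A f → A h → Integrable (fun x => f x * h x * w x) μ)
  (hAc : ∀ ⦃f h : X → ℝ⦄ (c : ℝ), A f → A h → A (fun x => f x + c * h x))
  (hst : ∀ P ∈ ops, ∀ ⦃f : X → ℝ⦄, A f → A (P f))
  (hli : ∀ P ∈ ops, ∀ ⦃f h : X → ℝ⦄ (c : ℝ), A f → A h →
    ∀ x, P (fun s => f s + c * h s) x = P f x + c * P h x)
  (hsy : ∀ P ∈ ops, ∀ ⦃f h : X → ℝ⦄, A f → A h →
    ∫ x, P f x * h x * w x ∂μ = ∫ x, f x * P h x * w x ∂μ)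
  (hco : ∀ P ∈ ops, ∀ ⦃f : X → ℝ⦄, A f → ∫ x, P f x ^ 2 * w x ∂μ ≤ ∫ x, f x ^ 2 * w x ∂μ)

/-! Forward and backward sweeps score identically at every lag (equal autocovariances, Abel sums and
`τ_int`): `RevOp.autocov_eq_of_adjoint` / `abelSum_eq_of_adjoint` / `tauInt_eq_of_adjoint` with
`foldr_adjoint`; the forward-then-backward palindrome `F ∘ B` is a positive reversible exact sampler:
`RevOp.palin_autocov_nonneg` / `palin_autocov_succ_le` with the same inputs (one-line applications, not
restated here). -/

include hw0 hAi hAc hst hli hsy hco in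
/-- **THE FIXED DIRECTION IS NEVER WORSE THAN THE COIN-FLIPPED DIRECTION (Abel form, unconditional).**
With `S f = ½(F f + B f)` on the class, `S` is a reversible exact sampler and for every `g ∈ A`,
`0 ≤ r < 1`: `Σ_k ⟨g, Fᵏ g⟩ rᵏ ≤ Σ_k ⟨g, Sᵏ g⟩ rᵏ`. -/
theorem foldr_abelSum_le_directionMixture
    (hS : ∀ ⦃f : X → ℝ⦄, A f →
      ∀ x, S f x = (ops.foldr (fun P g => P g) f x + ops.reverse.foldr (fun P g => P g) f x) / 2)
    {g : X → ℝ} (hg : A g) {r : ℝ} (hr0 : 0 ≤ r) (hr1 : r < 1) :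
    ∑' k, (∫ x, g x * ((fun f => ops.foldr (fun P g => P g) f)^[k] g) x * w x ∂μ) * r ^ k
      ≤ ∑' k, (∫ x, g x * (S^[k] g) x * w x ∂μ) * r ^ k := by
  have hF := foldr_mem (A := A) hst
  have hB := foldr_mem (A := A) (reverse_mem hst)
  have hFl := foldr_lin (A := A) hst hli
  have hBl := foldr_lin (A := A) (reverse_mem hst) fun Q hQ => hli Q (List.mem_reverse.mp hQ)
  have hFc := foldr_contr (μ := μ) (w := w) hst hco
  have hadj := foldr_adjoint (μ := μ) (w := w) hst hsy
  exact abelSum_le_of_quadForm_le_nonrev hw0 hAi hAc hF hFl hFc (addRev_mem hAc hF hB hS)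
    (addRev_lin hAc hFl hBl hS) (addRev_symm hAi hF hB hadj hS)
    (addRev_contr hw0 hAi hF hB hadj hFc hS)
    (fun v hv => (quadForm_addRev_eq hAi hF hB hadj hS hv).symm.le) hg hr0 hr1

end Consequences

end RevOp

end Summit.Ventures.LatticeQCDFlow.Exactness
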